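import Summits.KontsevichZagierPeriods.KontsevichZagierPeriods.Theses.HodgeLevel
import Summits.KontsevichZagierPeriods.KontsevichZagierPeriods.Theorems.HurwitzMicroSectorsNormalFormPrincipleDimOneAssembly

/-!
# `DimOneRationalValues` (stmt-KontsevichZagierPeriods-4992, route HodgeLevel) — the value half of the
# dimension-one normal form of line `SketchIdeator1` (crux `NormalFormPrinciple`, stmt-3869)

**The value of every one-dimensional integral representation of KZ's rational shape is a Baker
period**: `r.value = β₀ + Σᵢ βᵢ yᵢ` with `β₀, βᵢ ∈ ℚ̄ ⊂ ℂ` and `exp yᵢ ∈ ℚ̄`.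

Proof. The lead seats c3/c4 of crux stmt-KontsevichZagierPeriods-3869 proved that every rational
representation `N` of dimension one is, modulo `KZ.relations`, a MIXED NORMAL FORM
`[pt, r] + Σⱼ Λ(uⱼ, cⱼ) + Σ_l T(t_l, d_l)` (`PiBox.Dlog.nfD_of_isRational_dim_one`: point representation
`[pt, r]`, dlog carriers `Λ(u, c) = [(1,u), c/y]`, arctangent carriers `T(t, d) = [(0,t), d/(1+y²)]`,
all data real algebraic, `uⱼ > 1`, `t_l ≥ 0`). Relations have value zero
(`KZ.relations_le_ker_eval_holds`), so
`N.value = r + Σ cⱼ log uⱼ + Σ d_l arctan t_l` (`value_pt`, `value_dlogA`, `value_angA`). Over `ℂ`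
this is `r + Σ cⱼ · log uⱼ + Σ (−i d_l) · (i arctan t_l)` with `exp (log uⱼ) = uⱼ ∈ ℚ̄` and
`exp (i arctan t_l) ∈ ℚ̄` (`isAlgebraic_exp_arctan_mul_I`), `−i d_l ∈ ℚ̄`.

This is the value-level content of the dimension-one layer of the leaf `stub_boxRigidity` of line
`SketchIdeator1`; it is verbatim the signature of item stmt-KontsevichZagierPeriods-4992
(`HodgeLevel.DimOneRationalValues`; Wan, *Degrees of periods*, arXiv:1102.2273, Thm 4.1 made precise).

Sources: M. Kontsevich, D. Zagier, *Periods* (2001), §1.1–1.2; A. Baker, *Transcendental Number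
Theory* (1975), Ch. 2. No definitions are introduced.
-/

noncomputable section

open MeasureTheory Set Finset Complex
open Literature.NumberTheory.Transcendental Literature.NumberTheory.Transcendental.KZ

namespace Summit.KontsevichZagierPeriods.HodgeLevel.DimOneRationalValues

open Summit.KontsevichZagierPeriods.HurwitzMicroSectors.NormalFormPrinciple.PiBox.Dlog

/-- **Real form.** The value of a one-dimensional representation of KZ's rational shape is
`r + Σⱼ cⱼ log uⱼ + Σ_l d_l arctan t_l` with all of `r, uⱼ > 1, cⱼ, t_l ≥ 0, d_l` real algebraic.
[cite: KontsevichZagier2001, §1.2] -/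
theorem value_eq_nf (N : IntegralRep 1) (hN : N.IsRational) :
    ∃ (r : ℝ) (k : ℕ) (u c : Fin k → ℝ) (k' : ℕ) (t d : Fin k' → ℝ), IsAlgebraic ℚ r ∧ (∀ j, 1 < u j) ∧
      (∀ j, IsAlgebraic ℚ (u j)) ∧ (∀ j, IsAlgebraic ℚ (c j)) ∧ (∀ l, 0 ≤ t l) ∧
      (∀ l, IsAlgebraic ℚ (t l)) ∧ (∀ l, IsAlgebraic ℚ (d l)) ∧
      N.value = r + ∑ j, c j * Real.log (u j) + ∑ l, d l * Real.arctan (t l) := by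
  classical
  obtain ⟨RA, hR⟩ := exists_carrierA
  obtain ⟨ZA, hZ⟩ := exists_ptCarrierA
  obtain ⟨RG, hRG⟩ := exists_angCarrier
  obtain ⟨r, k, u, c, k', t, d, hr, hu1, hu, hc, ht0, ht, hd, hEq⟩ :=
    nfD_of_isRational_dim_one hR hZ hRG N hN
  refine ⟨r, k, u, c, k', t, d, hr, hu1, hu, hc, ht0, ht, hd, ?_⟩
  -- the normal form differs from `[N]` by a relation, and relations have value `0`
  have hrep : of N - (of (ZA r) + ∑ j, of (RA 1 (u j) (c j)) + ∑ l, of (RG (t l) (d l))) ∈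
      relations := by
    rw [← QuotientAddGroup.eq_zero_iff]
    change QuotientAddGroup.mk' relations _ = 0
    rw [map_sub, map_add, map_add, map_sum, map_sum, hEq, sub_self]
  have h := relations_le_ker_eval_holds hrep
  rw [AddMonoidHom.mem_ker, map_sub, sub_eq_zero, map_add, map_add, map_sum, map_sum, eval_of] at h
  rw [h, eval_of, value_pt (ZA r) (hZ r hr).1 (hZ r hr).2]
  congr 1
  · congr 1
    refine Finset.sum_congr rfl fun j _ => ?_
    have hRj := hR 1 (u j) (c j) isAlgebraic_one (hu j) (hc j) one_pos
    have hEqOn : EqOn (RA 1 (u j) (c j)).integrand (fun x => c j / x 0) (RA 1 (u j) (c j)).domain := by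
      rw [hRj.2]; exact fun _ _ => rfl
    rw [eval_of, value_dlogA (RA 1 (u j) (c j)) hRj.1 hEqOn one_pos (hu1 j).le, div_one]
  · refine Finset.sum_congr rfl fun l _ => ?_
    have hRl := hRG (t l) (d l) (ht l) (hd l)
    rw [eval_of, value_angA (RG _ _) hRl.1 (by rw [hRl.2]; exact fun _ _ => rfl) (ht0 l),
      Real.arctan_zero, sub_zero]

/-- **The value of a one-dimensional representation of KZ's rational shape is a Baker period**
(item stmt-KontsevichZagierPeriods-4992, `HodgeLevel.DimOneRationalValues`): `r.value = β₀ + Σ βᵢ yᵢ`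
with `β₀, βᵢ` algebraic and `exp yᵢ` algebraic — from the mixed normal form of line `SketchIdeator1`
(`value_eq_nf`) with `yⱼ = log uⱼ`, `βⱼ = cⱼ` for the logarithms and `y_l = i·arctan t_l`,
`β_l = −i·d_l` for the angles. [cite: KontsevichZagier2001, §1.2] -/
theorem dimOneRationalValues_proof :
    Summit.KontsevichZagierPeriods.KontsevichZagierPeriods.Theses.HodgeLevel.DimOneRationalValues := by
  intro N hN
  obtain ⟨r, k, u, c, k', t, d, hr, hu1, hu, hc, -, ht, hd, hval⟩ := value_eq_nf N hN
  -- `i` and real algebraic numbers are algebraic complex numbers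
  have isAlgebraic_I : IsAlgebraic ℚ I :=
    IsAlgebraic.of_pow two_pos (by rw [Complex.I_sq]; exact isAlgebraic_one.neg)
  have isAlgebraic_ofReal : ∀ {x : ℝ}, IsAlgebraic ℚ x → IsAlgebraic ℚ (x : ℂ) := fun hx =>
    (isAlgebraic_algebraMap_iff (R := ℚ) (A := ℂ) Complex.ofReal_injective).mpr hx
  refine ⟨k + k', (r : ℂ), Fin.append (fun j => (c j : ℂ)) (fun l => -(I * (d l : ℂ))),
    Fin.append (fun j => ((Real.log (u j) : ℝ) : ℂ)) (fun l => (Real.arctan (t l) : ℂ) * I),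
    isAlgebraic_ofReal hr, ?_, ?_, ?_⟩
  · intro i
    refine Fin.addCases (fun j => ?_) (fun l => ?_) i
    · rw [Fin.append_left]; exact isAlgebraic_ofReal (hc j)
    · rw [Fin.append_right]; exact (isAlgebraic_I.mul (isAlgebraic_ofReal (hd l))).neg
  · intro i
    refine Fin.addCases (fun j => ?_) (fun l => ?_) i
    · rw [Fin.append_left, ← Complex.ofReal_exp, Real.exp_log (lt_trans one_pos (hu1 j))]
      exact isAlgebraic_ofReal (hu j)
    · rw [Fin.append_right]; exact isAlgebraic_exp_arctan_mul_I (ht l)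
  · have hsum : ∑ l, -(I * (d l : ℂ)) * ((Real.arctan (t l) : ℂ) * I) =
        ∑ l, ((d l * Real.arctan (t l) : ℝ) : ℂ) := by
      refine Finset.sum_congr rfl fun l _ => ?_
      rw [Complex.ofReal_mul]
      linear_combination (-(d l : ℂ) * (Real.arctan (t l) : ℂ)) * Complex.I_mul_I
    simp only [Fin.sum_univ_add, Fin.append_left, Fin.append_right]
    rw [hsum, hval]
    simp only [Complex.ofReal_add, Complex.ofReal_sum, Complex.ofReal_mul, add_assoc]

end Summit.KontsevichZagierPeriods.HodgeLevel.DimOneRationalValues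

end
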